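import Summits.NavierStokesRegularity.Statement
import Literature.StrongHypotheses.NavierStokesRegularity
import Summits.NavierStokesRegularity.NavierStokesRegularity.Cruxes.FluxZoom.Disproof
import HarnessLib
import HarnessLib.Audit.TribunalTags

/-!
# Summit `NavierStokesRegularity` — bridges of the Strong-Hypothesis Library (D-0034, skeleton)

Summit-side BRIDGE file for the registry `Literature/StrongHypotheses/NavierStokesRegularity.lean`:
for every `H` tagged with `@[strong_hypothesis "NavierStokesRegularity.NavierStokesRegularity"]`
exactly ONE bridge tagged `@[summit_bridge "NavierStokesRegularity.NavierStokesRegularity"]`,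
concluding the ROOT problem decl `_root_.NavierStokesRegularity`
(`Summits/NavierStokesRegularity/NavierStokesRegularity/Statement.lean`,
`:= Literature.NS.NavierStokesExistenceSmoothR3`, Fefferman's Clay statement (A); the `def` unfolds
by `Iff.rfl`). Written with the `_root_` prefix so that no namespace of the same name can capture
the identifier.

* SUMMIT-SIDE REGISTRATION (1): the equivalent criterion
  `Summit.NavierStokesRegularity.NavierStokesRegularity.Cruxes.FluxZoom.Disproof.NoBlowup` ("no
  finite-time blow-up of classical Leray–Hopf solutions from rapidly decaying data") is a closed
  `Prop` of a BUILT `Cruxes` module (Literature cannot import it), tagged here, with the LANDED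
  bridge `noBlowup_iff_navierStokesRegularity` = `navierStokesRegularity_iff_noBlowup.symm` (that
  module; its `←` half is the proved frame item `NoBlowupToClay`,
  `Theorems/TypeICertificateLadderNoBlowupToClay.lean`, over Leray 1934, Kato 1984, Prodi–Serrin
  and Lemarié-Rieusset 2016 Thm. 15.1; its `→` half is `Literature.NS.blowup_assembly` with the
  refuted `BlowupBlowupClayNonuniqueness`).
* LANDED bridge (1): `forcedR3_implies_navierStokesRegularity` — the forced hypothesis at `f = 0`
  is (A) verbatim (`IsSmoothOnHalfSpace 0` and `HasRapidSpaceTimeDecay 0` are trivial).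
* PRINTED bridge (1): `LerayHopfLThreeBoundImpliesNavierStokesRegularity` (ESS 2003 Thm. 1.4 +
  Leray 1934 + local theory), a NAMED FACT (CONVENTIONS §4) to be discharged by a literature-prover
  as `theorem LerayHopfLThreeBoundImpliesNavierStokesRegularity_holds` in
  `Summits/NavierStokesRegularity/NavierStokesRegularity/Theorems/StrongHypothesesLerayHopfLThreeBoundBridge.lean`
  (proof plan in its docstring).

No new mathematics is proved here; no `sorry`, no axiom.
-/

noncomputable section

open scoped ContDiff

/-! ## Summit-side conjecture `def`s, tagged in place (no restatement) -/

attribute [strong_hypothesis "NavierStokesRegularity.NavierStokesRegularity"]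
  Summit.NavierStokesRegularity.NavierStokesRegularity.Cruxes.FluxZoom.Disproof.NoBlowup

namespace Summit.NavierStokesRegularity.StrongHypotheses

open Literature.Analysis.FluidPDE
open Literature.StrongHypotheses.NavierStokesRegularity
open Summit.NavierStokesRegularity.NavierStokesRegularity.Cruxes.FluxZoom.Disproof (NoBlowup
  navierStokesRegularity_iff_noBlowup)

/-! ## Equivalent criterion (landed) -/

/-- **No blow-up ⇔ Clay (A)** (landed): `navierStokesRegularity_iff_noBlowup`
(`Cruxes/FluxZoom/Disproof.lean`, over the proved frame `NoBlowupToClay` and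
`Literature.NS.blowup_assembly`), read from the hypothesis side. [folklore] -/
@[summit_bridge "NavierStokesRegularity.NavierStokesRegularity"]
theorem noBlowup_iff_navierStokesRegularity : NoBlowup ↔ _root_.NavierStokesRegularity :=
  navierStokesRegularity_iff_noBlowup.symm

/-! ## Strictly stronger hypotheses -/

/-- **Forced Schwartz global regularity ⇒ Clay (A)** (landed): take the force `f = 0`, which is
smooth on the half-space and has space-time rapid decay trivially (all its derivatives vanish:
`iteratedFDerivWithin_zero`). Tao 2013 lists this as the trivial arrow Conj. 1.5 ⇒ Conj. 1.3.
[cite: Tao2013Localisation, Thm. 1.20 (iv) and Fig. 1] -/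
@[summit_bridge "NavierStokesRegularity.NavierStokesRegularity"]
theorem forcedR3_implies_navierStokesRegularity :
    NavierStokesExistenceSmoothForcedR3 → _root_.NavierStokesRegularity := by
  intro h ν hν u₀ hs hd hdec
  have h0 : Function.uncurry (0 : ℝ → EuclideanSpace ℝ (Fin 3) → EuclideanSpace ℝ (Fin 3)) =
      fun _ => 0 := rfl
  refine h ν hν u₀ 0 hs hd hdec ?_ ?_
  · show ContDiffOn ℝ ∞ (Function.uncurry (0 : ℝ → EuclideanSpace ℝ (Fin 3) →
      EuclideanSpace ℝ (Fin 3))) _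
    rw [h0]
    exact contDiffOn_const
  · intro n K
    refine ⟨0, fun t _ x => ?_⟩
    rw [h0, iteratedFDerivWithin_fun_zero]
    simp

/-- **`L^∞_t L³_x` bound for all Leray–Hopf solutions ⇒ Clay (A)** — named fact: the hypothesis
`Literature.StrongHypotheses.NavierStokesRegularity.LerayHopfLThreeBound` (every Leray–Hopf weak
solution of the unforced system on `ℝ³ × [0,T)` from a Clay datum lies in `L^∞(0,T; L³)`) implies
Fefferman's (A). Printed: Escauriaza–Seregin–Šverák 2003, Thm. 1.4 (`L_{3,∞}` Leray–Hopf solutions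
of the Cauchy problem are smooth on `(0,T) × ℝ³`; Robinson–Rodrigo–Sadowski 2016 Thm. 16.4), with
Leray's global existence (Leray 1934 Ch. V §31; in tree `leray_existence_R3`) and the local smooth
theory. PROOF PLAN for the discharge `theorem LerayHopfLThreeBoundImpliesNavierStokesRegularity_holds`:
go through `noBlowup_iff_navierStokesRegularity` (this file) and prove `H → NoBlowup`: given
`ν, T > 0` and a classical solution `(u, p)` on `[0, T)`, Leray–Hopf on `[0, T]` from the rapidly
decaying datum `u 0` (a Clay datum: `IsClassicalNSSolutionOn` gives smoothness and
`divFree`), (i) apply `H` on `[0, T']` for `T' > T` after grafting Leray's global weak solution from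
`u 0` beyond `T` (or apply `H` on `[0,T]` directly and use Seregin's criterion): `u ∈ L^∞(0,T; L³)`;
(ii) by `seregin_L3_blowup` (Seregin 2012 Thm. 1.1, named fact in `NSLerayHopf.lean`) a maximal
smooth solution that fails to extend past `T` has `‖u(t)‖_{L³} → ∞` as `t → T⁻`, contradicting (i)
(`u` is bounded on closed sub-strips since it is classical on `[0,T)` with decaying datum — use the
tree's Kato-class representative, `TypeICertificateLadderNoBlowupToClayLemmas`); alternatively use
`ess_endpoint` on `[0, T']` to get a classical representative on `(0, T')` ∋ `T` and conclude
`HasSmoothExtensionPast ν 0 u T` by uniqueness of classical solutions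
(`ClassicalNSKatoUniqueness`). [cite: EscauriazaSereginSverak2003, Thm. 1.4] -/
@[summit_bridge "NavierStokesRegularity.NavierStokesRegularity"]
def LerayHopfLThreeBoundImpliesNavierStokesRegularity : Prop :=
  LerayHopfLThreeBound → _root_.NavierStokesRegularity

end Summit.NavierStokesRegularity.StrongHypotheses
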